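import Summits.BirchSwinnertonDyer.BirchSwinnertonDyer.Theorems.CyclotomicUntwistPSUntwistedTrace
import Summits.BirchSwinnertonDyer.BirchSwinnertonDyer.Theorems.CyclotomicUntwistGNineSpecialFibrePointCount
import Summits.BirchSwinnertonDyer.BirchSwinnertonDyer.Theorems.CyclotomicUntwistGNineSpecialFibreInvariants
import HarnessLib

/-!
# LAW L-a3, the model-level certificate: on the two principal-series leaf families the closed form (N′)
# `psUntwistedTrace` IS the Frobenius trace `3 + 1 − #Ē_w(𝔽₃)` of the special fibre over `ℚ(ζ₉)`
# (route `CyclotomicUntwist`, cruxes K1 `PSRankOneLowerHalfAtThree` / K2 `PSRankOneUpperHalfAtThree`)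

Cell `pub/bsd-wall` (D-0145 line `route-BirchSwinnertonDyer-CyclotomicUntwist`), seat `bsd-line-cycu-p3` (gen 6).
Helper toward K1 (stmt-BirchSwinnertonDyer-21580) / K2 (stmt-21581). THEOREMS ONLY (no definition, no named fact,
no `sorry`); BSD is not proved by this file and no crux is.

THE CHAIN. For the leaf-II integer models `V = ⟨0, 3(3α₁ − g), 0, 9β, 3(3γ₁ + g)⟩` (`g = ±1`; every
principal-series curve with `v₃Δ_min = 4` is reached from its minimal model by `x ↦ 4x + r`, cycu-p1's S1 step)
and the leaf-IV models `V = ⟨0, 9α, 0, 9(3β₁ − 1), 9(3γ₁ + g)⟩` (`v₃Δ_min = 6`):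
(i) `CyclotomicUntwistGNineSpecialFibre` (p610052): the good model over `ℚ(ζ₉)` reduces mod `w` to
`y² = x³ − x + γ̄₁` (leaf II) / `y² = x³ − x − γ̄₁` (leaf IV);
(ii) `CyclotomicUntwistGNineSpecialFibrePointCount` (p617081): that curve over `𝔽₃` has
`3 + 1 − #Ē(𝔽₃) = −3·valMinAbs γ̄₁` / `+3·valMinAbs γ̄₁`;
(iii) THIS FILE: the definition `psUntwistedTrace` (p616806; closed form (N′) on `v₃Δ mod 12`, `c₆' mod 9`,
`Δ′ mod 9`) evaluated on `V/ℚ` gives the SAME integer. So on both families **(N′) = the special-fibre trace**,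
kernel-checked for all parameters — the model-level content of LAW L-a3 (N) of the crux memo
`LAW-La3-KERNEL-v3.md`; what stays informal is only the identification of that trace with `a₃(g) + a₃(ḡ)` for the
untwist ((T): Néron–Ogg–Shafarevich + Atkin–Li + Carayol) and the intrinsic local-minimal-model bookkeeping at `w`.

* leaf II: `leafII_c₆_eq` (`c₆ = 3³·c₆ᵘ`), `leafII_Δ_eq` (`Δ = 3⁴·Δᵘ`), `leafII_c₆u_emod_nine` (`c₆ᵘ ≡ 4g (mod 9)`),
  `leafII_Δu_emod_nine` (`Δᵘ ≡ 7 + 3gγ₁ (mod 9)`), **`psUntwistedTrace_leafII`**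
  (`a_w(V) = −3·valMinAbs γ̄₁`), **`psUntwistedTrace_leafII_eq_trace`** (`a_w(V) = 3 + 1 − #Ē(𝔽₃)` for
  `Ē : y² = x³ − x + γ̄₁`);
* leaf IV: `leafIV_c₆_eq` (`c₆ = 3⁵·c₆ᵘ`), `leafIV_Δ_eq` (`Δ = 3⁶·Δᵘ`), `leafIV_c₆u_emod_nine` (`c₆ᵘ ≡ 4g + 3γ₁ (mod 9)`),
  `leafIV_not_three_dvd_Δu`, **`psUntwistedTrace_leafIV`** (`a_w(V) = 3·valMinAbs γ̄₁`),
  **`psUntwistedTrace_leafIV_eq_trace`** (`a_w(V) = 3 + 1 − #Ē(𝔽₃)` for `Ē : y² = x³ − x − γ̄₁`).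
Polynomial identities by `ring` with machine-found cofactors (session folder `work/cert/leaf.py`); residues by `omega`.

References: J. Tate, LNM 476 (1975) §7 [Tate1975]; A. Kraus, Manuscripta Math. 69 (1990), Théorème (p = 3) [Kraus1990];
J. H. Silverman, *AEC* III.1, VII.1, V.2 [SilvermanAEC2009]; O. G. Rizzo, Compositio Math. 136 (2003) §1.1 [Rizzo2003].
-/

open scoped Classical

open WeierstrassCurve Literature.NumberTheory.EllipticCurves
  Summit.BirchSwinnertonDyer.BirchSwinnertonDyer.Theorems
  Summit.BirchSwinnertonDyer.BirchSwinnertonDyer.Theorems.PSRootNumberThreeTable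
  Summit.BirchSwinnertonDyer.BirchSwinnertonDyer.Theorems.GNineSpecialFibrePointCount

-- single-conjunct summit: `Summit.BirchSwinnertonDyer.BirchSwinnertonDyer.…` repeats the name by design
set_option linter.dupNamespace false
set_option autoImplicit false

namespace Summit.BirchSwinnertonDyer.BirchSwinnertonDyer.Theorems.PSUntwistedTrace

/-! ### Valuation and residue bookkeeping -/

/-- `v₃(3ᵏ·u) = k` for `3 ∤ u`. [folklore] -/
theorem padicValInt_three_pow_mul {u : ℤ} (k : ℕ) (hu : ¬ (3 : ℤ) ∣ u) : padicValInt 3 (3 ^ k * u) = k := by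
  have hu0 : u ≠ 0 := by rintro rfl; exact hu (dvd_zero 3)
  rw [padicValInt.mul (pow_ne_zero _ (by norm_num)) hu0,
    padicValInt.eq_zero_of_not_dvd (z := u) (by exact_mod_cast hu), add_zero]
  simp [padicValInt, Int.natAbs_pow]

/-- `v₃` of an integer cast to `ℚ`: `padicValRat 3 (3ᵏ·u) = k` for `3 ∤ u`. [folklore] -/
theorem padicValRat_intCast_three_pow_mul {u : ℤ} (k : ℕ) (hu : ¬ (3 : ℤ) ∣ u) :
    padicValRat 3 (((3 ^ k * u : ℤ) : ℚ)) = k := by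
  rw [padicValRat.of_int, padicValInt_three_pow_mul k hu]

/-- **(N′) on an integer model with `c₆ = 3ᵃ·c₆ᵘ`, `Δ = 3ᵛ·Δᵘ`, `3 ∤ c₆ᵘ Δᵘ`**: the untwisted trace of `V/ℚ` is
`untwistedTraceOfInvariants` evaluated at `v mod 12`, `c₆ᵘ mod 9`, `Δᵘ mod 9`:
here the `v = 4` branch `3·s(c₆ᵘ)·e(Δᵘ)`. [cite: Kraus1990, Théorème (p = 3)] [cite: Rizzo2003, §1.1–1.2 (notation x')] -/
theorem psUntwistedTrace_map_of_four (V : WeierstrassCurve ℤ) {c6u Du : ℤ} {a : ℕ}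
    (hc : V.c₆ = 3 ^ a * c6u) (hD : V.Δ = 3 ^ 4 * Du) (hcu : ¬ (3 : ℤ) ∣ c6u) (hDu : ¬ (3 : ℤ) ∣ Du) :
    (V.map (Int.castRingHom ℚ)).psUntwistedTrace = 3 * signNine (c6u % 9) * epsNine (Du % 9) := by
  have hΔQ : (V.map (Int.castRingHom ℚ)).Δ = ((V.Δ : ℤ) : ℚ) := by rw [map_Δ, eq_intCast]
  have hc6Q : (V.map (Int.castRingHom ℚ)).c₆ = ((V.c₆ : ℤ) : ℚ) := by rw [map_c₆, eq_intCast]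
  have hvΔ : padicValRat 3 (V.map (Int.castRingHom ℚ)).Δ = (4 : ℕ) := by
    rw [hΔQ, hD]; exact padicValRat_intCast_three_pow_mul 4 hDu
  have hv6 : padicValRat 3 ((V.c₆ : ℤ) : ℚ) = (a : ℕ) := by
    rw [hc]; exact padicValRat_intCast_three_pow_mul a hcu
  rw [psUntwistedTrace_def, untwistedTraceOfInvariants_of_four (by rw [hvΔ]; norm_num), hc6Q, hΔQ,
    res9_intCast_eq hc hv6, res9_intCast_eq hD (by rw [← hΔQ, hvΔ])]

/-- The `v = 6` branch of the same bookkeeping: `a_w(V) = T(c₆ᵘ mod 9)`. [cite: Kraus1990, Théorème (p = 3)]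
[cite: Rizzo2003, §1.1–1.2 (notation x')] -/
theorem psUntwistedTrace_map_of_six (V : WeierstrassCurve ℤ) {c6u Du : ℤ} {a : ℕ}
    (hc : V.c₆ = 3 ^ a * c6u) (hD : V.Δ = 3 ^ 6 * Du) (hcu : ¬ (3 : ℤ) ∣ c6u) (hDu : ¬ (3 : ℤ) ∣ Du) :
    (V.map (Int.castRingHom ℚ)).psUntwistedTrace = traceTableIV (c6u % 9) := by
  have hΔQ : (V.map (Int.castRingHom ℚ)).Δ = ((V.Δ : ℤ) : ℚ) := by rw [map_Δ, eq_intCast]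
  have hc6Q : (V.map (Int.castRingHom ℚ)).c₆ = ((V.c₆ : ℤ) : ℚ) := by rw [map_c₆, eq_intCast]
  have hvΔ : padicValRat 3 (V.map (Int.castRingHom ℚ)).Δ = (6 : ℕ) := by
    rw [hΔQ, hD]; exact padicValRat_intCast_three_pow_mul 6 hDu
  have hv6 : padicValRat 3 ((V.c₆ : ℤ) : ℚ) = (a : ℕ) := by
    rw [hc]; exact padicValRat_intCast_three_pow_mul a hcu
  rw [psUntwistedTrace_def, untwistedTraceOfInvariants_of_six (by rw [hvΔ]; norm_num), hc6Q,
    res9_intCast_eq hc hv6]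

/-- `γ₁ mod 3` trichotomy with the matching `valMinAbs γ̄₁ ∈ {0, 1, −1}`. [folklore] -/
theorem valMinAbs_intCast_three (γ₁ : ℤ) :
    (γ₁ % 3 = 0 ∧ ZMod.valMinAbs (γ₁ : ZMod 3) = 0) ∨ (γ₁ % 3 = 1 ∧ ZMod.valMinAbs (γ₁ : ZMod 3) = 1) ∨
      (γ₁ % 3 = 2 ∧ ZMod.valMinAbs (γ₁ : ZMod 3) = -1) := by
  obtain ⟨v0, v1, v2⟩ := valMinAbs_three_values
  have hcast : (γ₁ : ZMod 3) = ((γ₁ % 3 : ℤ) : ZMod 3) := (ZMod.intCast_mod γ₁ 3).symm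
  have h3 : γ₁ % 3 = 0 ∨ γ₁ % 3 = 1 ∨ γ₁ % 3 = 2 := by omega
  rcases h3 with h | h | h
  · left; refine ⟨h, ?_⟩; rw [hcast, h]; exact_mod_cast v0
  · right; left; refine ⟨h, ?_⟩; rw [hcast, h]; exact_mod_cast v1
  · right; right; refine ⟨h, ?_⟩; rw [hcast, h]; exact_mod_cast v2

/-! ### Leaf II: `V = ⟨0, 3(3α₁ − g), 0, 9β, 3(3γ₁ + g)⟩`, `v₃Δ = 4` -/

section LeafII

variable (α₁ β γ₁ g : ℤ)

/-- `c₆` of the leaf-II model: `c₆ = 3³ · c₆ᵘ` with `c₆ᵘ` explicit (`= c₆/27` of `leafII_c₆`). [cite: Tate1975, §7] -/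
theorem leafII_c₆_eq :
    (⟨0, 3 * (3 * α₁ - g), 0, 9 * β, 3 * (3 * γ₁ + g)⟩ : WeierstrassCurve ℤ).c₆ =
      3 ^ 3 * (64 * g ^ 3 - 576 * α₁ * g ^ 2 + 1728 * α₁ ^ 2 * g - 1728 * α₁ ^ 3 - 288 * β * g + 864 * α₁ * β
        - 96 * g - 288 * γ₁) := by
  simp only [WeierstrassCurve.c₆, WeierstrassCurve.b₂, WeierstrassCurve.b₄, WeierstrassCurve.b₆]
  ring

/-- `Δ` of the leaf-II model: `Δ = 3⁴ · Δᵘ` with `Δᵘ = 16·D₄` explicit (`D₄` of cycu-p1's GNINE-RECIPES, leaf II).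
[cite: Tate1975, §7] -/
theorem leafII_Δ_eq :
    (⟨0, 3 * (3 * α₁ - g), 0, 9 * β, 3 * (3 * γ₁ + g)⟩ : WeierstrassCurve ℤ).Δ =
      3 ^ 4 * (64 * g ^ 4 + 192 * γ₁ * g ^ 3 + 144 * β ^ 2 * g ^ 2 - 576 * α₁ * g ^ 3 - 1728 * α₁ * γ₁ * g ^ 2
        - 864 * α₁ * β ^ 2 * g + 1728 * α₁ ^ 2 * g ^ 2 + 5184 * α₁ ^ 2 * γ₁ * g + 1296 * α₁ ^ 2 * β ^ 2
        - 1728 * α₁ ^ 3 * g - 5184 * α₁ ^ 3 * γ₁ - 288 * β * g ^ 2 - 864 * β * γ₁ * g - 576 * β ^ 3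
        + 864 * α₁ * β * g + 2592 * α₁ * β * γ₁ - 48 * g ^ 2 - 288 * γ₁ * g - 432 * γ₁ ^ 2) := by
  simp only [WeierstrassCurve.Δ, WeierstrassCurve.b₂, WeierstrassCurve.b₄, WeierstrassCurve.b₆,
    WeierstrassCurve.b₈]
  ring

variable {g}

/-- Leaf II, `g = ±1`: **`c₆ᵘ ≡ 4g (mod 9)`** (so the sign datum is `s(c₆ᵘ) = g`). [cite: Kraus1990, Théorème (p = 3)] -/
theorem leafII_c₆u_emod_nine (hg : g ^ 2 = 1) :
    (64 * g ^ 3 - 576 * α₁ * g ^ 2 + 1728 * α₁ ^ 2 * g - 1728 * α₁ ^ 3 - 288 * β * g + 864 * α₁ * β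
        - 96 * g - 288 * γ₁) % 9 = (4 * g) % 9 := by
  have key : (64 * g ^ 3 - 576 * α₁ * g ^ 2 + 1728 * α₁ ^ 2 * g - 1728 * α₁ ^ 3 - 288 * β * g + 864 * α₁ * β
        - 96 * g - 288 * γ₁) - 4 * g =
      9 * (192 * α₁ ^ 2 * g - 192 * α₁ ^ 3 - 32 * β * g + 96 * α₁ * β - 4 * g - 32 * γ₁ - 64 * α₁) +
        (64 * g - 576 * α₁) * (g ^ 2 - 1) := by ring
  have key' : (64 * g ^ 3 - 576 * α₁ * g ^ 2 + 1728 * α₁ ^ 2 * g - 1728 * α₁ ^ 3 - 288 * β * g + 864 * α₁ * β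
        - 96 * g - 288 * γ₁) - 4 * g =
      9 * (192 * α₁ ^ 2 * g - 192 * α₁ ^ 3 - 32 * β * g + 96 * α₁ * β - 4 * g - 32 * γ₁ - 64 * α₁) := by
    rw [key, hg]; ring
  exact Int.modEq_iff_dvd.mpr ⟨-(192 * α₁ ^ 2 * g - 192 * α₁ ^ 3 - 32 * β * g + 96 * α₁ * β - 4 * g - 32 * γ₁
      - 64 * α₁), by linear_combination -key'⟩

/-- Leaf II, `g = ±1`: **`Δᵘ ≡ 7 + 3gγ₁ (mod 9)`** (so the `Δ′`-digit is `e(Δᵘ) = −⟨gγ₁⟩`). [cite: Kraus1990, Théorème (p = 3)] -/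
theorem leafII_Δu_emod_nine (hg : g ^ 2 = 1) :
    (64 * g ^ 4 + 192 * γ₁ * g ^ 3 + 144 * β ^ 2 * g ^ 2 - 576 * α₁ * g ^ 3 - 1728 * α₁ * γ₁ * g ^ 2
        - 864 * α₁ * β ^ 2 * g + 1728 * α₁ ^ 2 * g ^ 2 + 5184 * α₁ ^ 2 * γ₁ * g + 1296 * α₁ ^ 2 * β ^ 2
        - 1728 * α₁ ^ 3 * g - 5184 * α₁ ^ 3 * γ₁ - 288 * β * g ^ 2 - 864 * β * γ₁ * g - 576 * β ^ 3
        + 864 * α₁ * β * g + 2592 * α₁ * β * γ₁ - 48 * g ^ 2 - 288 * γ₁ * g - 432 * γ₁ ^ 2) % 9 =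
      (7 + 3 * g * γ₁) % 9 := by
  have key : (64 * g ^ 4 + 192 * γ₁ * g ^ 3 + 144 * β ^ 2 * g ^ 2 - 576 * α₁ * g ^ 3 - 1728 * α₁ * γ₁ * g ^ 2
        - 864 * α₁ * β ^ 2 * g + 1728 * α₁ ^ 2 * g ^ 2 + 5184 * α₁ ^ 2 * γ₁ * g + 1296 * α₁ ^ 2 * β ^ 2
        - 1728 * α₁ ^ 3 * g - 5184 * α₁ ^ 3 * γ₁ - 288 * β * g ^ 2 - 864 * β * γ₁ * g - 576 * β ^ 3
        + 864 * α₁ * β * g + 2592 * α₁ * β * γ₁ - 48 * g ^ 2 - 288 * γ₁ * g - 432 * γ₁ ^ 2) - (7 + 3 * g * γ₁) =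
      9 * (-96 * α₁ * β ^ 2 * g + 576 * α₁ ^ 2 * γ₁ * g + 144 * α₁ ^ 2 * β ^ 2 - 192 * α₁ ^ 3 * g
          - 576 * α₁ ^ 3 * γ₁ - 96 * β * γ₁ * g - 64 * β ^ 3 + 96 * α₁ * β * g + 288 * α₁ * β * γ₁
          - 11 * γ₁ * g - 48 * γ₁ ^ 2 + 16 * β ^ 2 - 64 * α₁ * g - 192 * α₁ * γ₁ + 192 * α₁ ^ 2 - 32 * β + 1) +
        (64 * g ^ 2 + 192 * γ₁ * g + 144 * β ^ 2 - 576 * α₁ * g - 1728 * α₁ * γ₁ + 1728 * α₁ ^ 2 - 288 * β + 16) *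
          (g ^ 2 - 1) := by ring
  have key' : (64 * g ^ 4 + 192 * γ₁ * g ^ 3 + 144 * β ^ 2 * g ^ 2 - 576 * α₁ * g ^ 3 - 1728 * α₁ * γ₁ * g ^ 2
        - 864 * α₁ * β ^ 2 * g + 1728 * α₁ ^ 2 * g ^ 2 + 5184 * α₁ ^ 2 * γ₁ * g + 1296 * α₁ ^ 2 * β ^ 2
        - 1728 * α₁ ^ 3 * g - 5184 * α₁ ^ 3 * γ₁ - 288 * β * g ^ 2 - 864 * β * γ₁ * g - 576 * β ^ 3
        + 864 * α₁ * β * g + 2592 * α₁ * β * γ₁ - 48 * g ^ 2 - 288 * γ₁ * g - 432 * γ₁ ^ 2) - (7 + 3 * g * γ₁) =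
      9 * (-96 * α₁ * β ^ 2 * g + 576 * α₁ ^ 2 * γ₁ * g + 144 * α₁ ^ 2 * β ^ 2 - 192 * α₁ ^ 3 * g
          - 576 * α₁ ^ 3 * γ₁ - 96 * β * γ₁ * g - 64 * β ^ 3 + 96 * α₁ * β * g + 288 * α₁ * β * γ₁
          - 11 * γ₁ * g - 48 * γ₁ ^ 2 + 16 * β ^ 2 - 64 * α₁ * g - 192 * α₁ * γ₁ + 192 * α₁ ^ 2 - 32 * β + 1) := by
    rw [key, hg]; ring
  exact Int.modEq_iff_dvd.mpr ⟨-(-96 * α₁ * β ^ 2 * g + 576 * α₁ ^ 2 * γ₁ * g + 144 * α₁ ^ 2 * β ^ 2 - 192 * α₁ ^ 3 * g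
          - 576 * α₁ ^ 3 * γ₁ - 96 * β * γ₁ * g - 64 * β ^ 3 + 96 * α₁ * β * g + 288 * α₁ * β * γ₁
          - 11 * γ₁ * g - 48 * γ₁ ^ 2 + 16 * β ^ 2 - 64 * α₁ * g - 192 * α₁ * γ₁ + 192 * α₁ ^ 2 - 32 * β + 1),
    by linear_combination -key'⟩

/-- **LAW L-a3 (N′) on leaf II: `a_w(V) = −3·valMinAbs γ̄₁`** for every `α₁ β γ₁` and `g = ±1`.
[cite: Kraus1990, Théorème (p = 3)] [cite: Tate1975, §7] -/
theorem psUntwistedTrace_leafII (hg : g ^ 2 = 1) :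
    ((⟨0, 3 * (3 * α₁ - g), 0, 9 * β, 3 * (3 * γ₁ + g)⟩ : WeierstrassCurve ℤ).map
        (Int.castRingHom ℚ)).psUntwistedTrace = -3 * ZMod.valMinAbs (γ₁ : ZMod 3) := by
  have hc6u := leafII_c₆u_emod_nine α₁ β γ₁ hg
  have hDu := leafII_Δu_emod_nine α₁ β γ₁ hg
  rcases GNineSpecialFibre.eq_one_or_eq_neg_one_of_sq hg with rfl | rfl
  all_goals
    rw [psUntwistedTrace_map_of_four _ (leafII_c₆_eq α₁ β γ₁ _) (leafII_Δ_eq α₁ β γ₁ _) (by omega) (by omega),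
      hc6u, hDu]
    rcases valMinAbs_intCast_three γ₁ with ⟨h, hv⟩ | ⟨h, hv⟩ | ⟨h, hv⟩ <;> rw [hv]
  · rw [show (7 + 3 * 1 * γ₁) % 9 = 7 by omega]; decide
  · rw [show (7 + 3 * 1 * γ₁) % 9 = 1 by omega]; decide
  · rw [show (7 + 3 * 1 * γ₁) % 9 = 4 by omega]; decide
  · rw [show (7 + 3 * -1 * γ₁) % 9 = 7 by omega]; decide
  · rw [show (7 + 3 * -1 * γ₁) % 9 = 4 by omega]; decide
  · rw [show (7 + 3 * -1 * γ₁) % 9 = 1 by omega]; decide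

/-- **Leaf II: (N′) is the special-fibre trace.** `a_w(V) = 3 + 1 − #Ē(𝔽₃)` for `Ē : y² = x³ − x + γ̄₁`, the special
fibre of the good model over `ℚ(ζ₉)` (`GNineSpecialFibre.leafII_special_fibre`). [cite: Kraus1990, Théorème (p = 3)]
[cite: SilvermanAEC2009, V.2] -/
theorem psUntwistedTrace_leafII_eq_trace (hg : g ^ 2 = 1) :
    ((⟨0, 3 * (3 * α₁ - g), 0, 9 * β, 3 * (3 * γ₁ + g)⟩ : WeierstrassCurve ℤ).map
        (Int.castRingHom ℚ)).psUntwistedTrace =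
      (3 : ℤ) + 1 - Nat.card (⟨0, 0, 0, -1, (γ₁ : ZMod 3)⟩ : WeierstrassCurve (ZMod 3)).toAffine.Point := by
  rw [psUntwistedTrace_leafII α₁ β γ₁ hg, trace_specialFibre]

end LeafII

/-! ### Leaf IV: `V = ⟨0, 9α, 0, 9(3β₁ − 1), 9(3γ₁ + g)⟩`, `v₃Δ = 6` -/

section LeafIV

variable (α β₁ γ₁ g : ℤ)

/-- `c₆` of the leaf-IV model: `c₆ = 3⁵ · c₆ᵘ`, `c₆ᵘ = 32·(−6α³ + 9αβ₁ − 3α − 3γ₁ − g)` (`leafIV_c₆`). [cite: Tate1975, §7] -/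
theorem leafIV_c₆_eq :
    (⟨0, 9 * α, 0, 9 * (3 * β₁ - 1), 9 * (3 * γ₁ + g)⟩ : WeierstrassCurve ℤ).c₆ =
      3 ^ 5 * (-192 * α ^ 3 + 288 * α * β₁ - 32 * g - 96 * γ₁ - 96 * α) := by
  simp only [WeierstrassCurve.c₆, WeierstrassCurve.b₂, WeierstrassCurve.b₄, WeierstrassCurve.b₆]
  ring

/-- `Δ` of the leaf-IV model: `Δ = 3⁶ · Δᵘ`, `Δᵘ = 16·D₆` explicit. [cite: Tate1975, §7] -/
theorem leafIV_Δ_eq :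
    (⟨0, 9 * α, 0, 9 * (3 * β₁ - 1), 9 * (3 * γ₁ + g)⟩ : WeierstrassCurve ℤ).Δ =
      3 ^ 6 * (1296 * α ^ 2 * β₁ ^ 2 - 576 * α ^ 3 * g - 1728 * α ^ 3 * γ₁ - 1728 * β₁ ^ 3 + 864 * α * β₁ * g
        + 2592 * α * β₁ * γ₁ - 864 * α ^ 2 * β₁ - 48 * g ^ 2 - 288 * γ₁ * g - 432 * γ₁ ^ 2 + 1728 * β₁ ^ 2
        - 288 * α * g - 864 * α * γ₁ + 144 * α ^ 2 - 576 * β₁ + 64) := by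
  simp only [WeierstrassCurve.Δ, WeierstrassCurve.b₂, WeierstrassCurve.b₄, WeierstrassCurve.b₆,
    WeierstrassCurve.b₈]
  ring

variable {g}

/-- Leaf IV, `g = ±1`: **`c₆ᵘ ≡ 4g + 3γ₁ (mod 9)`** (using `3 ∣ α³ − α`). [cite: Kraus1990, Théorème (p = 3)] -/
theorem leafIV_c₆u_emod_nine :
    (-192 * α ^ 3 + 288 * α * β₁ - 32 * g - 96 * γ₁ - 96 * α) % 9 = (4 * g + 3 * γ₁) % 9 := by
  have hf : (3 : ℤ) ∣ α ^ 3 - α := by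
    have h : ((α ^ 3 - α : ℤ) : ZMod 3) = 0 := by
      have key : ∀ x : ZMod 3, x ^ 3 - x = 0 := by decide
      push_cast
      exact key _
    exact (ZMod.intCast_zmod_eq_zero_iff_dvd _ 3).mp h
  obtain ⟨k, hk⟩ := hf
  have key : (-192 * α ^ 3 + 288 * α * β₁ - 32 * g - 96 * γ₁ - 96 * α) - (4 * g + 3 * γ₁) =
      9 * (32 * α * β₁ - 4 * g - 11 * γ₁ - 32 * α - 64 * k) := by linear_combination -192 * hk
  exact Int.modEq_iff_dvd.mpr ⟨-(32 * α * β₁ - 4 * g - 11 * γ₁ - 32 * α - 64 * k), by linear_combination -key⟩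

/-- Leaf IV, `g = ±1`: `3 ∤ Δᵘ` (indeed `Δᵘ ≡ 1 (mod 3)`), so `v₃Δ = 6` exactly. [cite: Kraus1990, Théorème (p = 3)] -/
theorem leafIV_not_three_dvd_Δu (hg : g ^ 2 = 1) :
    ¬ (3 : ℤ) ∣ (1296 * α ^ 2 * β₁ ^ 2 - 576 * α ^ 3 * g - 1728 * α ^ 3 * γ₁ - 1728 * β₁ ^ 3 + 864 * α * β₁ * g
        + 2592 * α * β₁ * γ₁ - 864 * α ^ 2 * β₁ - 48 * g ^ 2 - 288 * γ₁ * g - 432 * γ₁ ^ 2 + 1728 * β₁ ^ 2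
        - 288 * α * g - 864 * α * γ₁ + 144 * α ^ 2 - 576 * β₁ + 64) := by
  have key : (1296 * α ^ 2 * β₁ ^ 2 - 576 * α ^ 3 * g - 1728 * α ^ 3 * γ₁ - 1728 * β₁ ^ 3 + 864 * α * β₁ * g
        + 2592 * α * β₁ * γ₁ - 864 * α ^ 2 * β₁ - 48 * g ^ 2 - 288 * γ₁ * g - 432 * γ₁ ^ 2 + 1728 * β₁ ^ 2
        - 288 * α * g - 864 * α * γ₁ + 144 * α ^ 2 - 576 * β₁ + 64) =
      1 + 3 * (432 * α ^ 2 * β₁ ^ 2 - 192 * α ^ 3 * g - 576 * α ^ 3 * γ₁ - 576 * β₁ ^ 3 + 288 * α * β₁ * g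
          + 864 * α * β₁ * γ₁ - 288 * α ^ 2 * β₁ - 96 * γ₁ * g - 144 * γ₁ ^ 2 + 576 * β₁ ^ 2 - 96 * α * g
          - 288 * α * γ₁ + 48 * α ^ 2 - 192 * β₁ + 5) - 48 * (g ^ 2 - 1) := by ring
  have key' : (1296 * α ^ 2 * β₁ ^ 2 - 576 * α ^ 3 * g - 1728 * α ^ 3 * γ₁ - 1728 * β₁ ^ 3 + 864 * α * β₁ * g
        + 2592 * α * β₁ * γ₁ - 864 * α ^ 2 * β₁ - 48 * g ^ 2 - 288 * γ₁ * g - 432 * γ₁ ^ 2 + 1728 * β₁ ^ 2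
        - 288 * α * g - 864 * α * γ₁ + 144 * α ^ 2 - 576 * β₁ + 64) =
      1 + 3 * (432 * α ^ 2 * β₁ ^ 2 - 192 * α ^ 3 * g - 576 * α ^ 3 * γ₁ - 576 * β₁ ^ 3 + 288 * α * β₁ * g
          + 864 * α * β₁ * γ₁ - 288 * α ^ 2 * β₁ - 96 * γ₁ * g - 144 * γ₁ ^ 2 + 576 * β₁ ^ 2 - 96 * α * g
          - 288 * α * γ₁ + 48 * α ^ 2 - 192 * β₁ + 5) := by
    rw [key, hg]; ring
  rw [key']
  omega

/-- **LAW L-a3 (N′) on leaf IV: `a_w(V) = 3·valMinAbs γ̄₁`** for every `α β₁ γ₁` and `g = ±1`.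
[cite: Kraus1990, Théorème (p = 3)] [cite: Tate1975, §7] -/
theorem psUntwistedTrace_leafIV (hg : g ^ 2 = 1) :
    ((⟨0, 9 * α, 0, 9 * (3 * β₁ - 1), 9 * (3 * γ₁ + g)⟩ : WeierstrassCurve ℤ).map
        (Int.castRingHom ℚ)).psUntwistedTrace = 3 * ZMod.valMinAbs (γ₁ : ZMod 3) := by
  have hc6u := leafIV_c₆u_emod_nine α β₁ γ₁ (g := g)
  have hDu := leafIV_not_three_dvd_Δu α β₁ γ₁ hg
  rcases GNineSpecialFibre.eq_one_or_eq_neg_one_of_sq hg with rfl | rfl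
  all_goals
    rw [psUntwistedTrace_map_of_six _ (leafIV_c₆_eq α β₁ γ₁ _) (leafIV_Δ_eq α β₁ γ₁ _) (by omega) hDu, hc6u]
    rcases valMinAbs_intCast_three γ₁ with ⟨h, hv⟩ | ⟨h, hv⟩ | ⟨h, hv⟩ <;> rw [hv]
  · rw [show (4 * 1 + 3 * γ₁) % 9 = 4 by omega]; decide
  · rw [show (4 * 1 + 3 * γ₁) % 9 = 7 by omega]; decide
  · rw [show (4 * 1 + 3 * γ₁) % 9 = 1 by omega]; decide
  · rw [show (4 * -1 + 3 * γ₁) % 9 = 5 by omega]; decide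
  · rw [show (4 * -1 + 3 * γ₁) % 9 = 8 by omega]; decide
  · rw [show (4 * -1 + 3 * γ₁) % 9 = 2 by omega]; decide

/-- **Leaf IV: (N′) is the special-fibre trace.** `a_w(V) = 3 + 1 − #Ē(𝔽₃)` for `Ē : y² = x³ − x − γ̄₁`, the special
fibre of the good model over `ℚ(ζ₉)` (`GNineSpecialFibre.leafIV_special_fibre`). [cite: Kraus1990, Théorème (p = 3)]
[cite: SilvermanAEC2009, V.2] -/
theorem psUntwistedTrace_leafIV_eq_trace (hg : g ^ 2 = 1) :
    ((⟨0, 9 * α, 0, 9 * (3 * β₁ - 1), 9 * (3 * γ₁ + g)⟩ : WeierstrassCurve ℤ).map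
        (Int.castRingHom ℚ)).psUntwistedTrace =
      (3 : ℤ) + 1 - Nat.card (⟨0, 0, 0, -1, -(γ₁ : ZMod 3)⟩ : WeierstrassCurve (ZMod 3)).toAffine.Point := by
  rw [psUntwistedTrace_leafIV α β₁ γ₁ hg, trace_specialFibre]
  have : ZMod.valMinAbs (-(γ₁ : ZMod 3)) = -ZMod.valMinAbs (γ₁ : ZMod 3) := by
    rcases zmod_three_cases (γ₁ : ZMod 3) with h | h | h <;> rw [h] <;> decide
  rw [this]; ring

end LeafIV

end Summit.BirchSwinnertonDyer.BirchSwinnertonDyer.Theorems.PSUntwistedTrace
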